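import Summits.BirchSwinnertonDyer.BirchSwinnertonDyer.Theorems.UniversalToricDescentRoadFFRationalDescent
import HarnessLib

/-!
# Route `UniversalToricDescent`, ♭B column (cruxes `TwinSplitIMCAtThreeMult` 20694 / ♭B_T `TwinWanFrameAtThreeMultT` 27172),
# line `membertower`: the Road-FF one-sided congruence limit with a PER-LEVEL `p^{e_m}` twist, UNTWISTED by prime avoidance —
# the member tower needs no `m`-UNIFORM exponent, only `limsup (m − e_m) = ∞` (abstract algebra; the K1b brick N1 of
# memo MEMBER-INCLUSION-AT3-g12 §2)

Cell `bsd-wall` (run/shared/lean/pub/bsd-wall/), seat `bsd-wall-utd-p2` (lead prover g12, 2026-08-28);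
`--supports stmt-BirchSwinnertonDyer-20694 --as helper`; Theses-free, pure algebra.

## Why

Lead g11's rational descent (p612782 `CongruenceDescent.map_le_span_of_oneSided_congruences_descent_le_of_le_span_mul`,
p616714) consumes member inclusions twisted by ONE element `a` for all levels `m` — at the twin, `a = p^e` with `e`
INDEPENDENT of `m` (stub K1b «m-uniformity», the one hypothesis of the member tower with no printed source). This file
removes the uniformity from the ALGEBRA: if the level-`m` member inclusion is twisted by `p^{e_m}` with `e_m ≤ m` and the
target series `L` AVOIDS `p` (`p·y ∈ (L) ⇒ y ∈ (L)`; in `R₀⟦T⟧` this is `p ∤ L`, i.e. `μ(L) = 0`, `avoid_of_not_C_dvd`),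
then the level-`m` congruence «`p^{e_m}·J·S ⊆ (L) + (p^m)`» UNTWISTS to «`J·S ⊆ (L) + (p^{m−e_m})`»
(`le_sup_span_pow_of_span_pow_mul_le`), and Krull's intersection theorem along ANY sequence of levels with `m − e_m → ∞`
gives `J·S ⊆ (L)` (`map_le_span_of_oneSided_congruences_descent_le_perLevel`). So the member tower's exponent may GROW
with the level, as long as it grows slower than the level; and when each member's own function has `μ = 0` (Hsieh 2014
Thm. B in weight `k_m`, typer ask T-μk) the member inclusions are integral up to a fixed exponent and the hypothesis is void.

* §1 `le_sup_span_pow_of_span_pow_mul_le` — untwisting mod `π^m` under `π`-avoidance (any commutative ring).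
* §2 `map_le_span_of_oneSided_congruences_descent_le_perLevel` — the per-level-twisted one-sided congruence limit
  (`S` Noetherian, `φ(π) ∈ Jac S`), from p612782's per-level step `map_span_mul_fittingIdeal_le_sup_of_congruence_descent_le`.
* §3 `avoid_of_not_C_dvd` — in `Λ_{R₀} = R₀⟦T⟧`, `C p ∤ L` gives the avoidance hypothesis (`C p` is prime:
  `prime_C_of_prime`, `CongruenceDescent.prime_natCast_p_unrIntegers`); `avoid_of_isUnit_coeff` — from a unit coefficient.

HONEST FRAMING: theorems only (no definition, no named fact, no instance, no `sorry`); nothing about any curve is asserted;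
BSD is proved for no curve. References: [Skinner2016PacificMC] §3.1 (p. 192) (the congruence-limit mechanism);
[StacksProject] Tag 05GI (Krull), Tag 07ZA (Fitting ideals); [Washington1997] §7.1 (`p` prime in `R₀⟦T⟧`).
-/

noncomputable section

open scoped Classical TensorProduct

open PowerSeries Literature.NumberTheory.EllipticCurves Literature.RingTheory.FittingIdeal
open Summit.BirchSwinnertonDyer.Rank1Residual.X11b.Halves

namespace Summit.BirchSwinnertonDyer.Rank1Residual.X11b.CongruenceDescent

universe u v w

/-! ### §1 Untwisting mod `π^m` under `π`-avoidance -/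

/-- Iterated avoidance: if `π·y ∈ (L) ⇒ y ∈ (L)` then `π^k·y ∈ (L) ⇒ y ∈ (L)`. [folklore] -/
theorem mem_span_of_pow_mul_mem_span_of_avoid {S : Type u} [CommRing S] {π L : S}
    (hav : ∀ y : S, π * y ∈ Ideal.span ({L} : Set S) → y ∈ Ideal.span ({L} : Set S)) :
    ∀ (k : ℕ) (y : S), π ^ k * y ∈ Ideal.span ({L} : Set S) → y ∈ Ideal.span ({L} : Set S) := by
  intro k
  induction k with
  | zero => intro y hy; simpa using hy
  | succ k ih =>
      intro y hy
      rw [pow_succ, mul_assoc] at hy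
      exact hav y (ih (π * y) hy)

/-- **Untwisting mod `π^m`.** In a commutative ring, if `L` avoids `π` (`π·y ∈ (L) ⇒ y ∈ (L)`), `e ≤ m`, and
`(π^e)·J ⊆ (L) + (π)^m`, then `J ⊆ (L) + (π)^{m−e}`: write `π^e x = gL + hπ^m`, so `π^e (x − hπ^{m−e}) ∈ (L)`, avoid `e`
times. [folklore] -/
theorem le_sup_span_pow_of_span_pow_mul_le {S : Type u} [CommRing S] {π L : S} {J : Ideal S} {e m : ℕ}
    (hav : ∀ y : S, π * y ∈ Ideal.span ({L} : Set S) → y ∈ Ideal.span ({L} : Set S)) (hem : e ≤ m)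
    (h : Ideal.span {π ^ e} * J ≤ Ideal.span {L} ⊔ Ideal.span {π} ^ m) :
    J ≤ Ideal.span {L} ⊔ Ideal.span {π} ^ (m - e) := by
  intro x hx
  have hx' : π ^ e * x ∈ Ideal.span {L} ⊔ Ideal.span {π} ^ m :=
    h (Ideal.mul_mem_mul (Ideal.mem_span_singleton_self _) hx)
  rw [Ideal.span_singleton_pow] at hx' ⊢
  obtain ⟨u, hu, v, hv, huv⟩ := Submodule.mem_sup.mp hx'
  obtain ⟨g, rfl⟩ := Ideal.mem_span_singleton'.mp hu
  obtain ⟨h', rfl⟩ := Ideal.mem_span_singleton'.mp hv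
  have hm' : π ^ m = π ^ e * π ^ (m - e) := by rw [← pow_add, Nat.add_sub_cancel' hem]
  have key : π ^ e * (x - h' * π ^ (m - e)) ∈ Ideal.span ({L} : Set S) := by
    have hcalc : π ^ e * (x - h' * π ^ (m - e)) = g * L := by
      rw [mul_sub, ← huv, hm']; ring
    rw [hcalc]
    exact Ideal.mem_span_singleton'.mpr ⟨g, rfl⟩
  have hy : x - h' * π ^ (m - e) ∈ Ideal.span ({L} : Set S) :=
    mem_span_of_pow_mul_mem_span_of_avoid hav e _ key
  have hz : h' * π ^ (m - e) ∈ Ideal.span ({π ^ (m - e)} : Set S) := Ideal.mem_span_singleton'.mpr ⟨h', rfl⟩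
  have hsum := Submodule.add_mem_sup hy hz
  rwa [sub_add_cancel] at hsum

/-! ### §2 The one-sided congruence limit with a PER-LEVEL twist -/

variable {R : Type*} [CommRing R] {S : Type u} [CommRing S] (φ : R →+* S)
  {M : Type*} [AddCommGroup M] [Module R M] [Module.Finite R M]

/-- **The one-sided congruence limit, per-member coefficients, (c) one-sided, TWISTED AT LEVEL `m` BY `πR^{e_m}` and
UNTWISTED.** `S` Noetherian, `π := φ(πR) ∈ Jac(S)`, `L` avoids `π`; `J ⊆ Fitt_R(M)`; for every `m ≥ 1` a coefficient
square with `S'_m` faithfully flat over `S`, a finite `R'_m`-module `N_m` with `(R'_m ⊗_R M)/πR^m ≅ N_m/πR^m`, the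
TWISTED member inclusion `(πR^{e_m}·Fitt_{R'_m}(N_m))·S'_m ⊆ (L_m)` and `(L_m) ⊆ (L) + πR^m S'_m`; and the exponents
satisfy `∀ n ∃ m ≥ 1, e_m + n ≤ m` (they grow slower than the level along some sequence). Then `J·S ⊆ (L)`: per level,
p612782's step gives `π^{e_m}·Fitt_R(M)·S ⊆ (L) + (π)^m`, §1 untwists it to `Fitt_R(M)·S ⊆ (L) + (π)^{m−e_m} ⊆ (L) + (π)^n`,
and Krull's theorem (`CongruenceLimit.iInf_sup_pow_eq_self`) intersects over `n`. The uniform case `e_m = e` is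
p612782's `map_le_span_of_oneSided_congruences_descent_le_of_le_span_mul` followed by one avoidance.
[cite: Skinner2016PacificMC, §3.1 (p. 192)] [cite: StacksProject, Tag 05GI (Krull's intersection theorem)] -/
theorem map_le_span_of_oneSided_congruences_descent_le_perLevel [IsNoetherianRing S]
    (πR : R) (hI : (Ideal.span {πR}).map φ ≤ (⊥ : Ideal S).jacobson)
    {J : Ideal R} (hJ : J ≤ Module.fittingIdeal R M 0) (L : S)
    (hav : ∀ y : S, φ πR * y ∈ Ideal.span ({L} : Set S) → y ∈ Ideal.span ({L} : Set S))
    (e : ℕ → ℕ) (hunb : ∀ n : ℕ, ∃ m : ℕ, 1 ≤ m ∧ e m + n ≤ m)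
    (R' : ℕ → Type v) [∀ m, CommRing (R' m)] [∀ m, Algebra R (R' m)]
    (S' : ℕ → Type w) [∀ m, CommRing (S' m)] [∀ m, Algebra S (S' m)]
    [∀ m, Module.FaithfullyFlat S (S' m)] (φ' : ∀ m, R' m →+* S' m)
    (hφ' : ∀ m, (φ' m).comp (algebraMap R (R' m)) = (algebraMap S (S' m)).comp φ)
    (N : ℕ → Type*) [∀ m, AddCommGroup (N m)] [∀ m, Module (R' m) (N m)]
    [∀ m, Module.Finite (R' m) (N m)] (Lm : ∀ m, S' m)
    (eqv : ∀ m : ℕ, 1 ≤ m →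
      (((R' m ⊗[R] M) ⧸ (((Ideal.span {πR}).map (algebraMap R (R' m))) ^ m •
          (⊤ : Submodule (R' m) (R' m ⊗[R] M)))) ≃ₗ[R' m]
        (N m ⧸ (((Ideal.span {πR}).map (algebraMap R (R' m))) ^ m • (⊤ : Submodule (R' m) (N m))))))
    (hF : ∀ m : ℕ, 1 ≤ m →
      (Ideal.span {algebraMap R (R' m) (πR ^ e m)} * Module.fittingIdeal (R' m) (N m) 0).map (φ' m) ≤
        Ideal.span {Lm m})
    (hc : ∀ m : ℕ, 1 ≤ m →
      Ideal.span {Lm m} ≤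
        Ideal.span {algebraMap S (S' m) L} ⊔ (((Ideal.span {πR}).map φ).map (algebraMap S (S' m))) ^ m) :
    J.map φ ≤ Ideal.span {L} := by
  have hmapI : (Ideal.span {πR}).map φ = Ideal.span {φ πR} := by
    rw [Ideal.map_span, Set.image_singleton]
  refine (Ideal.map_mono hJ).trans ?_
  rw [← CongruenceLimit.iInf_sup_pow_eq_self ((Ideal.span {πR}).map φ) (Ideal.span {L}) hI]
  refine le_iInf fun n ↦ ?_
  obtain ⟨m, hm, hmn⟩ := hunb n
  have step := map_span_mul_fittingIdeal_le_sup_of_congruence_descent_le φ (Ideal.span {πR}) (πR ^ e m)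
    (R' m) (S' m) (φ' m) (hφ' m) (N m) (eqv m hm) (hF m hm) (hc m hm)
  -- `step : (span{πR^{e m}} * Fitt).map φ ≤ span{L} ⊔ ((span{πR}).map φ)^m`
  rw [Ideal.map_mul, Ideal.map_span, Set.image_singleton, map_pow, hmapI] at step
  have h2 := le_sup_span_pow_of_span_pow_mul_le hav (by omega : e m ≤ m) step
  rw [hmapI]
  exact h2.trans (sup_le_sup_left (Ideal.pow_le_pow_right (by omega : n ≤ m - e m)) _)

end Summit.BirchSwinnertonDyer.Rank1Residual.X11b.CongruenceDescent

/-! ### §3 The avoidance hypothesis in `Λ_{R₀} = R₀⟦T⟧` -/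

namespace Summit.BirchSwinnertonDyer.Rank1Residual.X11b.Halves

variable {p : ℕ} [Fact p.Prime]

/-- **`C p ∤ L` ⟹ `L` avoids `C p` in `R₀⟦T⟧`**: `C p` is a prime element (`R₀⟦T⟧/(p) ≅ 𝔽̄_p⟦T⟧` is a domain;
`prime_C_of_prime`, `CongruenceDescent.prime_natCast_p_unrIntegers`), so `C p ∣ y·L`, `C p ∤ L` give `C p ∣ y`, and `C p`
cancels in the domain `R₀⟦T⟧`. [cite: Washington1997, §7.1 (`Λ` is a UFD; `p` prime)] -/
theorem avoid_of_not_C_dvd {L : UnrSeries p} (hL : ¬ ((C ((p : ℕ) : unrIntegers p) : UnrSeries p) ∣ L)) :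
    ∀ y : UnrSeries p, (C ((p : ℕ) : unrIntegers p) : UnrSeries p) * y ∈ Ideal.span ({L} : Set (UnrSeries p)) →
      y ∈ Ideal.span ({L} : Set (UnrSeries p)) := by
  have hprime : Prime (C ((p : ℕ) : unrIntegers p) : UnrSeries p) :=
    prime_C_of_prime CongruenceDescent.prime_natCast_p_unrIntegers
  intro y hy
  obtain ⟨z, hz⟩ := Ideal.mem_span_singleton'.mp hy
  -- `hz : z * L = C p * y`
  have hdvd : (C ((p : ℕ) : unrIntegers p) : UnrSeries p) ∣ z * L := ⟨y, hz⟩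
  rcases hprime.dvd_or_dvd hdvd with hz' | hL'
  · obtain ⟨w, rfl⟩ := hz'
    have hy' : y = w * L := by
      apply mul_left_cancel₀ hprime.ne_zero
      rw [← hz, mul_assoc]
    rw [hy']
    exact Ideal.mul_mem_left _ w (Ideal.mem_span_singleton_self L)
  · exact absurd hL' hL

/-- **A unit coefficient (`μ(L) = 0`) ⟹ `L` avoids `C p`** (`not_C_dvd_of_isUnit_coeff` + `avoid_of_not_C_dvd`).
[cite: Washington1997, §7.1] -/
theorem avoid_of_isUnit_coeff {L : UnrSeries p} (hμ : ∃ i : ℕ, IsUnit (PowerSeries.coeff i L)) :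
    ∀ y : UnrSeries p, (C ((p : ℕ) : unrIntegers p) : UnrSeries p) * y ∈ Ideal.span ({L} : Set (UnrSeries p)) →
      y ∈ Ideal.span ({L} : Set (UnrSeries p)) := by
  refine avoid_of_not_C_dvd ?_
  rintro ⟨M, hM⟩
  obtain ⟨i, hi⟩ := hμ
  rw [hM, PowerSeries.coeff_C_mul] at hi
  exact CongruenceDescent.prime_natCast_p_unrIntegers.not_unit (isUnit_of_mul_isUnit_left hi)

end Summit.BirchSwinnertonDyer.Rank1Residual.X11b.Halves

end
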